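import Mathlib
import HarnessLib
import HarnessLib.Audit
import Summits.FinalStateConjecture.Statement
import HarnessLib.Audit.Status.Attr

/-!
Route: PhotonSphereCapacity

# Route PhotonSphereCapacity — no soft geons — settling = (generic entry into the breather-free C²
tube around receding Kerrs) + (the tube is breather-free), priced by the η² photon-sphere capacity

It suffices to show X = B ∧ A ∧ E (card no-soft-geons-photon-sphere-capacity, spine). B
(NoSoftBreather, the card's
"no soft geons / last breather"): for every sub-extremality margin δ > 0 there is a tube width ε₀(δ)
> 0 such that EVERY
maximal vacuum Cauchy development (of any admissible datum) with complete 𝓘⁺ whose exterior O is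
exhaustively charted and
eventually stays within MASS-NORMALISED C² deviation ε ≤ ε₀ of finitely many receding unit Kerr
exteriors with |â| ≤ 1 − δ
plus a radiation zone within ε of η, settles down in the sense of the Statement (honest
FinalStateDecomposition, sub-extremal,
O = exteriorOf, HasExhaustiveCharts). A (SubcriticalFinalState, the complement): for generic
admissible data every MGHD has
complete 𝓘⁺ and ends up STRICTLY SUB-CRITICAL — quasi-settled within half the breather-free radius
sup{ε ≤ 1 : all tubes of width ≤ ε are breather-free}/2. E (MGHDExistence, support): admissible data
have an MGHD. The
mechanism crux K1 (CapacityLaw: a self-made null-potential well of mass fraction η outside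
Schwarzschild has relative depth
O(η²)) is what makes the breather-free radius LARGE (soft geons do not exist) and A a coarse
statement; it feeds the proof of B,
not the glue. Mass normalisation of the tube (background ⟨Kerr.exterior 1 â, M²·Kerr.bilin 1 â,
M·y⁰, M·r̂⟩, bound M²ε) is
load-bearing: an un-normalised C² tube equals a C⁰ tube by scaling and would admit pre-formed HARD
shells, the card's
codimension-one residual, which belongs to A's exceptional set and not to B.
Lean: `NoSoftBreather ∧ SubcriticalFinalState ∧ MGHDExistence`

## Assembly
Pure logic plus exceptional-set monotonicity of Christodoulou codimension (sorry-free in the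
planner's Sketch2.lean / glue.lean,
theorem `closes`, lean check rc 0): fix X; for an admissible d satisfying A's property take any MGHD
𝒟: A gives complete 𝓘⁺, a margin δ and
a (δ, ε⋆)-quasi-settled O with ε⋆ = sSup S/2, S = {ε ∈ (0,1] : all tubes ≤ ε breather-free}; B gives
ε₀(δ) > 0 with min(ε₀,1) ∈ S, so
0 < sSup S, ε⋆ < sSup S and some ε' ∈ S exceeds ε⋆, whence the tube (δ, ε⋆) is breather-free and 𝒟
settles; E supplies the MGHD. Hence
A's exceptional set contains the Statement's, and HasCodimAtLeastIn is monotone under shrinking the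
exceptional set. CapacityLaw,
PhotonSphereFlatness and ThinShellWell are mechanism items (they price the tube) and are not
hypotheses of `closes`.

Rationale: WHY THIS LINE. The card inverts the settling clause: a complete-𝓘⁺ exterior that never settles needs
an eternal reservoir of exterior energy; finite-frequency
energy on Kerr's normally hyperbolic trapped set leaks at the Lyapunov rate, so the reservoir must
be STABLY trapped, and in vacuum the only
stable trapping is self-made — a graviton shell between the remnant's photon sphere 3M_BH and 3M —
whose WKB capacity is O(η²) because the
photon orbit is a non-degenerate maximum (thin traceless shell: R_eq = 3M_BH(1 + η/2 + η²/4 − η³/8 +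
O(η⁴)), depth η²/36 M_BH⁻², re-derived
and checked numerically in this unit), hence no quasi-bound state below ℓ* ≈ 2.4 η⁻²
(arXiv:2102.08170 for the kinetic shells,
doi:10.1007/978-3-030-46622-0 §4.14.2 and arXiv:1404.7036 for long-lived modes under stable
trapping, arXiv:2411.17445 for the cascade that
would feed them, arXiv:1402.4859 for the near-extremal degeneration). Typed over the audited prelude
this becomes a TUBE DICHOTOMY that no prior
statement on this summit has: B = "the mass-normalised C² tube around receding sub-extremal Kerrs is
breather-free" (an asymptotic-from-orbital
stability statement on the whole sub-extremal range, nearest print: non-existence of genuinely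
time-PERIODIC AF vacuum near infinity,
arXiv:1504.04592, doi:10.1088/0264-9381/27/5/055007, and small-data Kerr stability arXiv:2104.11857
/ arXiv:2205.14808 / arXiv:2104.08222) and
A = "generic developments enter it with room to spare". Imported areas: semiclassical
tunnelling/Agmon pricing of quasimodes (spectral theory)
for the size of the tube, static Einstein–anisotropic-matter ODE theory
(doi:10.1016/j.jde.2008.05.010) for K1, dynamical-systems basin
language (orbital ⇒ asymptotic) for B; genericity is kept in ONE generic statement (A) because
Christodoulou genericity is not closed under ∧.

RANKED CRUXES. #2 NoSoftBreather (crux) — for every margin δ > 0 there is ε₀ > 0 such that for all 0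
< ε ≤ ε₀, every 3-manifold X, admissible datum D, MGHD 𝒟 with complete 𝓘⁺ and O ⊆ 𝒟: IF O is (δ,
ε)-QUASI-SETTLED — there are N, masses Mᵢ > 0, normalised spins |âᵢ| ≤ 1 − δ, motions (Λᵢ, cᵢ), a
late time τ₀, a flat domain U ⊇ {x⁰ > τ₀} minus sublinear tubes around the holes' world-lines, radii
R_j(τ), and a family of late charts ψ_j into O indexed by Fin (N+1) — ψ₀ on the flat background ⟨U,
η, x⁰, radius 0⟩ (never truncated, R₀ ≥ 0) and ψ_{i+1} on the MASS-NORMALISED Kerr background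
⟨Kerr.exterior 1 âᵢ, Mᵢ²·Kerr.bilin 1 âᵢ, Mᵢy⁰, Mᵢr̂⟩ — with the hole tubes separating, EVENTUALLY
truncDeviationC²(ψ_j) ≤ w_j ε out to R_j(τ) (w₀ = 1, w_{i+1} = Mᵢ², i.e. |h|, Mᵢ|∂h|, Mᵢ²|∂²h| ≤ ε),
the certified regions exhausting O (for every τ₁ > τ₀ each point of O outside ⋃_j ψ_j{t > τ₁, r ≤
R_j(t)} is causally before ⋃_j ψ_j{t = τ₁, r ≤ R_j(τ₁)}) and O = exteriorOf(⋃_j ψ_j{t > τ₀}) — THEN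
𝒟 settles in the sense of the Statement: ∃ O', d : FinalStateDecomposition 𝒟 O' 2 with every hole
sub-extremal, O' = exteriorOf d.charted and HasExhaustiveCharts d (card: no soft geons + basin
attractivity; the tube is C²-normalised so that hard shells are outside it). [difficulty:
open-problem] (why it might fail: An eternal SOFT breather — a C²-small, finite-amplitude,
never-decaying vacuum exterior hovering near sub-extremal Kerr (AF cousin of AdS geons,
doi:10.1088/0264-9381/29/19/194002) — or ε₀(δ)→0 failing to tame near-extremal turbulence
(arXiv:1402.4859); only time-PERIODIC ones are excluded in print.) [arXiv:1504.04592,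
doi:10.1088/0264-9381/27/5/055007, arXiv:2104.11857, arXiv:2205.14808, arXiv:2104.08222,
arXiv:1402.4859, arXiv:2411.17445, arXiv:1404.7036]
#3 CapacityLaw (crux) — (card K1, spherical form) there are κ, η₀ > 0 such that for every static
spherically symmetric configuration outside a Schwarzschild interior of mass M_BH — mass function m,
potential ν, density ρ, radial/tangential pressures p, q ≥ 0 on r > 2M_BH with m' = 4πr²ρ, ν' = (m +
4πr³p)/(r(r − 2m)), anisotropic TOV p' = −(ρ + p)ν' + 2(q − p)/r, massless matter ρ = p + 2q, no
horizon 2m < r, total mass m ≤ (1 + η)M_BH with 0 < η ≤ η₀, and a vacuum gap above the horizon (m =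
M_BH, ρ = p = 0 on (2M_BH, R₁]) — every well of the null potential V = e^{2ν}/r² has relative depth
≤ κη²: min(V r₁, V r₂) ≤ (1 + κη²)·V r_b whenever 2M_BH < r₁ < r_b < r₂. [difficulty: M] (why it
might fail: Radial pressure between the bottom and the outer top adds FIRST-order redshift
2∫4πr²p/(r−2m)dr; only the TOV balance caps p at O(ηρ·width/M) — a thick equilibrium shell with p/ρ
= O(1) over width O(M_BH) gives depth O(η); κ may blow up for nested shells.) [arXiv:2102.08170,
doi:10.1016/j.jde.2008.05.010, doi:10.1007/s00220-007-0285-4, arXiv:1511.01290,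
doi:10.1088/0264-9381/7/4/011]
#4 SubcriticalFinalState (crux) — (the complement; card (ii) 'born not made' in coarse form) for
every 3-manifold X, Christodoulou-generically in admissibleVacuumData X: every MGHD 𝒟 has complete
𝓘⁺ AND there are a margin δ > 0 and O ⊆ 𝒟 such that O is (δ, ε⋆)-quasi-settled exactly as in
NoSoftBreather's hypothesis, with ε⋆ := sSup{ε : 0 < ε ≤ 1 ∧ every (δ, ε')-tube with ε' ≤ ε is
breather-free}/2 — generic developments end up exhaustively charted within HALF THE BREATHER-FREE
RADIUS of finitely many receding (1−δ)-sub-extremal Kerrs plus radiation (contains weak cosmic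
censorship, N < ∞ and coarse large-data ringdown; pre-formed hard shells, extremal and naked knives
are its exceptional set). [deps: NoSoftBreather] [difficulty: open-problem] (why it might fail:
Contains WCC, N<∞ and large-data ringdown; fails if an OPEN set of data keeps C²-hard debris forever
(turbulent hard shells as attractors, arXiv:2411.17445), if remnant spins creep to extremality
generically, or if the breather-free radius is only perturbatively small.) [arXiv:1710.01722,
arXiv:0805.3880, arXiv:2104.08222, arXiv:2205.14808, arXiv:1610.08908, arXiv:2411.17445,
doi:10.1103/physrevd.44.1891]
#9 MGHDExistence (support) — every admissible vacuum datum on a connected Hausdorff second-countable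
3-manifold has a maximal vacuum Cauchy development (Choquet-Bruhat–Geroch 1969 over the repaired
structure VacuumCauchyDevelopment of the prelude; Sbierski's dezornification); the anti-vacuity
conjunct of the Statement. [difficulty: XL] [ChoquetBruhatGeroch1969CMP, arXiv:1309.7591,
Ringstrom2009]
#9 PhotonSphereFlatness (support) — (card P1(a), the signature identity of the mechanism) the
Schwarzschild null potential V_M(r) = (1 − 2M/r)/r² is second-order flat at the photon sphere:
1/(27M²) − V_M(3M(1 + x)) = x²(3 + x)/(27M²(1 + x)³) for M > 0, x > −1 (proved in the planner's
Sketch.lean by field_simp; ring). [difficulty: provable-now] [arXiv:0811.0354,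
doi:10.1007/978-3-030-46622-0]
#9 ThinShellWell (support) — (card P1(c), the law is attained) there are C, η₀ > 0 such that for 0 <
η ≤ η₀ and M_BH > 0 the traceless Israel junction condition M/√f_M(R) − M_BH/√f_{M_BH}(R) =
2R(√f_{M_BH}(R) − √f_M(R)) (f_m(R) = 1 − 2m/R, M = (1 + η)M_BH) has a root R with 3M_BH < R < 3M, |R
− 3M_BH(1 + η/2)| ≤ Cη²M_BH, and the glued potential (C_in(1 − 2M_BH/r)/r² inside, (1 − 2M/r)/r²
outside, C_in = f_M(R)/f_{M_BH}(R)) has well depth min(tops) − V(R) = η²/(36M_BH²) + O(η³)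
(numerically checked in this unit: depth/(η²/36) = 0.996, 0.964, 0.70 at η = 10⁻³, 10⁻², 10⁻¹; root
error O(η⁴)). [difficulty: M] [doi:10.1088/0264-9381/7/4/011, doi:10.1103/physrevd.44.1891,
arXiv:2102.08170]

TWO-LAYER PLAN. Foreseen glued splits (k ≤ 3, depth 1; nothing filed now). NoSoftBreather ⇐
OrbitalToAsymptoticSmallTube (ε₀ perturbative: asymptotic
stability from uniform-in-time closeness on the full sub-extremal range, the DRSR/Teukolsky linear
theory as engine) → TubeExtension (the
breather-free radius reaches the self-trapping amplitude: card K2's no-bootstrap inequality, using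
CapacityLaw on a dynamical background)
→ NoSoftBreather. SubcriticalFinalState ⇐ CoarseFinalState (generic developments are eventually
quasi-settled for SOME ε, hard-shell /
extremal / naked knives escapable: card K3 plus the census cards) → SofteningBelowThreshold (debris
below ℓ* softens to ε⋆: card (ii)) →
SubcriticalFinalState. CapacityLaw ⇐ ThinShellExtremality (lumping maximises depth at fixed η) →
ThinShellWell.

KILL CRITERIA. Close `refuted:NoSoftBreather` on an explicit eternal soft breather (a complete-𝓘⁺
vacuum exterior, C²-close to sub-extremal Kerr for all
late times, not converging) — this also refutes the card's mechanism. A static traceless TOV profile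
with well depth ≫ η² (e.g. ∝ η) refutes
CapacityLaw: pivot only if the counter-profile is not self-trapped (restate K1 over Vlasov shells),
else close `refuted:CapacityLaw`. An
open set of data with eternal C²-hard turbulent shells (the arXiv:2411.17445 scenario) refutes
SubcriticalFinalState AND the intended
conjecture — hand the witness to the negative side. Kerr stability on the full sub-extremal range
proved elsewhere moots the small-tube
child of B, not B.

NOT DECOMPOSED YET. The perturbative child of B (orbital ⇒ asymptotic for small ε₀) and its
constants; the Agmon/WKB no-resonance bound below ℓ* (card P2) and
the Kerr version of K1 with κ(a) ↑ ∞ as a → M; the no-bootstrap inequality (card K2) and hard-shell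
criticality (card K3), which need the
definitions requested below before they can be typed; the non-spherical (hoop-priced) lumps of K1.
All are layer-2 children.

CHEAPEST FALSIFIER. For K1: integrate the static anisotropic TOV system for a one-parameter family
of THICK traceless shells (p/ρ up to 1/3 at mid-shell) of
mass fraction η = 0.01…0.3 around Schwarzschild and fit the deepest well against η — an exponent
visibly below 2 kills CapacityLaw (the
thin-shell end was run here and in the card's j000730/j000785: exponent 1.93–1.98, coefficient →
1/36). For B: a literature lookup for ANY
asymptotically flat vacuum (or Einstein–massless-Vlasov) exterior that is uniformly close to Kerr
for all time without converging; none
found (only the time-periodic case is excluded in print, arXiv:1504.04592).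

NUMBERS. Thin traceless shell (this unit, bisection on the junction equation): R_eq − 3(1 + η/2 +
η²/4 − η³/8) = −1.5·10⁻¹³, −1.8·10⁻⁹, −1.4·10⁻⁷,
−1.4·10⁻⁵ at η = 10⁻³, 10⁻², 3·10⁻², 10⁻¹ (O(η⁴)); depth/(η²/36) = 0.996, 0.964, 0.896, 0.698, 0.355
at η = 10⁻³, 10⁻², 3·10⁻², 0.1, 0.3;
inner top − outer top = +3.7·10⁻¹¹ … +3.7·10⁻⁴ (O(η³), inner higher). Card: ℓ* = 2.37 η^−1.98; Kerr
prograde Lyapunov exponents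
λM = 0.192, 0.136, 0.060, 0.021 at a/M = 0, 0.9, 0.99, 0.999. Items at open: 7 (3 cruxes, 3 support,
assembly).

DEFINITION REQUESTS. To type the card's K2/K3 as layer-2 children: (D1)
`QuasiFinalStateDecomposition 𝓢 O k δ ε` — the (δ, ε)-tube hypothesis of
NoSoftBreather as a named structure in Literature/Geometry/Lorentzian (it is inlined three times in
this route); (D2) an exterior
trapped-energy functional with angular cut-off on a quasi-settled exterior (photon-sphere capacity
𝒮(η; a), threshold ℓ*(η; a)); (D3)
`HardShellData` (admissible data containing a pre-formed self-trapped high-frequency shell) for the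
fourth-knife statement. Filed after
open with `ledger workitem add --kind definition`.

Novelty: Searches (2026-08-15, this unit, on top of the card's battery and the novelty audit's): `lit
frontier FinalStateConjecture --since 2020` (30 rows;
nothing on breathers/orbital⇒asymptotic); `lit bridges FinalStateConjecture --cross any` (30 rows,
surveys only); `lit search --source arxiv
"time-periodic vacuum spacetimes Alexakis Schlue"` (1: arXiv:1504.04592); `lit search --source
crossref "time periodic asymptotically flat
Einstein … Bičák Scholtz Tod"` (doi:10.1088/0264-9381/27/5/055007,
doi:10.1088/0264-9381/27/17/175011); `lit search --source crossref "sharp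
bounds on 2m/r … Andréasson"` (doi:10.1016/j.jde.2008.05.010, doi:10.1007/s00220-007-0285-4); `lit
search --source crossref "gravitational
turbulent instability of anti-de Sitter space geons"` (doi:10.1088/0264-9381/29/19/194002,
doi:10.4310/sdg.2015.v20.n1.a13); `lit search
--hybrid --source local "stable trapping photon sphere ultracompact long-lived modes nonlinear
instability"` (held: doi:10.1007/978-3-030-46622-0,
read §4.14.2 p. 221 and fn. 13 p. 293); `lit galaxy search "gravitational geon" | "self-gravitating
shell" | "periodic in time" --star all`
(Wheeler/Ciufolini geon chapters, gr-qc/0112009; nothing pricing BH + shell); searchd/openalex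
partly rate-limited this session (logged).
Nearest prior art found: arXiv:1504.04592 and doi:10.1088/0264-9381/27/5/055007 (time-PERIODIC AF
vacuum is stationary near infinity — the
exactly periodic corner of NoSoftBreather); arXiv:2104.11857 / arXiv:2205.14808 / arXiv:2104  [refs: 10.1088/0264-9381/27/5/055007, 10.1088/0264-9381/27/17/175011, 10.1016/j.jde.2008.05.010, 10.1007/s00220-007-0285-4, 10.1088/0264-9381/29/19/194002, 10.4310/sdg.2015.v20.n1.a13, 10.1007/978-3-030-46622-0, 1504.04592, 2104.11857, 2205.14808, 2104.08222, 2102.08170, 2411.17445, 1402.4859, doi:10.1088/0264-9381/27/5/055007, doi:10.1088/0264-9381/27/17/175011, doi:10.1016/j.jde.2008.05.010, doi:10.100]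

Barriers (technique_class: self-trapping-threshold, semiclassical-capacity): - technique_class: self-trapping-threshold, semiclassical-capacity
- Literature.Barriers.FinalStateConjecture.SbierskiTrappingObstruction: evaded in statement and
intended proof — no derivative-loss-free LED through trapping is asserted; trapping enters B only
through the Lyapunov leak of the hyperbolically trapped part and the second-order flatness of its
maximum (K1), and B's hypothesis already grants uniform C² control for all time (the loss is paid by
the hypothesis, not claimed).
- Literature.Barriers.FinalStateConjecture.SlowlyRotatingKerrFrontier: it does not evade it; the bet
is that B's perturbative child (orbital ⇒ asymptotic, closeness GIVEN for all time) needs only the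
linear sub-extremal theory (DRSR, Teukolsky on |a| < M), not the GKS bootstrap — conceded open for
|a| not small.
- Literature.Barriers.FinalStateConjecture.AretakisInstability: evaded by the margin δ: B and A only
concern references with |â| ≤ 1 − δ and B's ε₀ depends on δ; the mechanism is declared to degenerate
as a → M (κ(a) ↑ ∞, λ → 0), consistent with the sub-extremality clause.
- Literature.Barriers.FinalStateConjecture.IonescuKlainermanNonExtension: not evaded — the
stationary-limit ⇒ Kerr step sits inside B's small-tube child, where closeness to Kerr makes the
Alexakis–Ionescu–Klainerman perturbative rigidity the relevant (known) evasion.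
- Literature.Barriers.FinalStateConjecture.KerrLinearHair: evaded by masslessness — vacuum
perturbations have no evanescent branch, which is exactly why f

sub-problem: FinalStateConjecture · status: open · opened planner-plancard-FinalStateConjecture-FinalSt-af71568c-0 2026-08-15T15:12:32Z · rev 1 · ledger route-FinalStateConjecture-PhotonSphereCapacity
GENERATED by the gate from the ledger (D-0016/17). Provers cite these decls: `theorem foo : Summit.FinalStateConjecture.FinalStateConjecture.Theses.PhotonSphereCapacity.<Decl> := …` in Summits/FinalStateConjecture/FinalStateConjecture/Theorems/<Name>.lean.
-/

namespace Summit.FinalStateConjecture.FinalStateConjecture.Theses.PhotonSphereCapacity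

open scoped BigOperators Topology Manifold Classical MeasureTheory ProbabilityTheory Matrix InnerProductSpace ComplexConjugate ContinuousMap
open Filter Set Function TopologicalSpace MeasureTheory

attribute [summit_statement] _root_.FinalStateConjecture

/-- item stmt-FinalStateConjecture-10118 · crux · rank 2 · open · by planner
why it might fail: For N′=1 already orbital⇒asymptotic Kerr stability for LARGE data on all |a|≤(1−δ)M (in print: small data, |a|≪M, arXiv:2205.14808); killed by an eternal C²-small AF soft breather (geon analogue, doi:10.1088/0264-9381/29/19/194002; only time-periodic excluded, 1504.04592) or ε₀(δ)→0 (1402.4859).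
sources: arXiv:2205.14808, arXiv:2104.11857, arXiv:2104.08222, arXiv:1504.04592, doi:10.1088/0264-9381/27/5/055007, doi:10.1088/0264-9381/29/19/194002
[crux] for every margin δ > 0 there is ε₀ > 0 such that for all 0 < ε ≤ ε₀, every 3-manifold X,
admissible datum D, MGHD 𝒟 with complete 𝓘⁺ and O ⊆ 𝒟: IF O is (δ, ε)-QUASI-SETTLED — there are N,
masses Mᵢ > 0, normalised spins |âᵢ| ≤ 1 − δ, motions (Λᵢ, cᵢ), a late time τ₀, a flat domain U ⊇
{x⁰ > τ₀} minus sublinear tubes around the holes' world-lines, radii R_j(τ), and a family of late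
charts ψ_j into O indexed by Fin (N+1) — ψ₀ on the flat background ⟨U, η, x⁰, radius 0⟩ (never
truncated, R₀ ≥ 0) and ψ_{i+1} on the MASS-NORMALISED Kerr background ⟨Kerr.exterior 1 âᵢ,
Mᵢ²·Kerr.bilin 1 âᵢ, Mᵢy⁰, Mᵢr̂⟩ — with the hole tubes separating, EVENTUALLY truncDeviationC²(ψ_j)
≤ w_j ε out to R_j(τ) (w₀ = 1, w_{i+1} = Mᵢ², i.e. |h|, Mᵢ|∂h|, Mᵢ²|∂²h| ≤ ε), the certified regions
exhausting O (for every τ₁ > τ₀ each point of O outside ⋃_j ψ_j{t > τ₁, r ≤ R_j(t)} is causally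
before ⋃_j ψ_j{t = τ₁, r ≤ R_j(τ₁)}) and O = exteriorOf(⋃_j ψ_j{t > τ₀}) — THEN 𝒟 settles in the
sense of the Statement: ∃ O', d : FinalStateDecomposition 𝒟 O' 2 with every hole sub-extremal, O' =
exteriorOf d.charted and HasExhaustiveCharts d (card: no soft geons + basin attractivity; the tube
is C²-normalised so that hard -/
@[route_item "route-FinalStateConjecture-PhotonSphereCapacity", crux]
def NoSoftBreather : Prop :=
  open Literature.Geometry.Lorentzian in ∀ δ : ℝ, 0 < δ → ∃ ε₀ : ℝ, 0 < ε₀ ∧ ∀ ε : ℝ, 0 < ε → ε ≤ ε₀ → (∀ (X' : Type) [TopologicalSpace X'] [ChartedSpace E3 X'] [IsManifold (𝓡 3) ((⊤ : ℕ∞) : WithTop ℕ∞) X'] [T2Space X'] [SecondCountableTopology X'] [ConnectedSpace X'], ∀ D' ∈ admissibleVacuumData X', ∀ 𝒟' : VacuumCauchyDevelopment D', 𝒟'.IsMaximal → Summit.FinalStateConjecture.HasCompleteNullInfinity 𝒟'.toCauchyDevelopment → ∀ O' : Set 𝒟'.carrier, (∃ (N' : ℕ) (M' â' : Fin N' → ℝ)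 (mo' : Fin N' → lorentzGroup × E4) (τ₀' : ℝ) (U' : TopologicalSpace.Opens E4) (ϱ' : Fin N' → ℝ → ℝ) (R' : Fin (N' + 1) → ℝ → ℝ), let B' : Fin (N' + 1) → ModelBackground := Fin.cases (motive := fun _ ↦ ModelBackground) ⟨U', fun _ ↦ Minkowski.bilin, fun x ↦ x 0, fun _ ↦ 0⟩ (fun i ↦ ⟨Kerr.exterior 1 (â' i), fun y ↦ (M' i ^ 2) • Kerr.bilin 1 (â' i) y, fun y ↦ M' i * y 0, fun y ↦ M' i * Kerr.radius (â' i) y⟩); let w' : Fin (N' + 1) → ℝ := Fin.cases (motive := fun _ ↦ ℝ) 1 (fun i ↦ M' i ^ 2); ∃ ψ' : ∀ j, (B' j).domain → 𝒟'.carrier, (∀ i, 0 < M' i ∧ |â' i| ≤ 1 - δ) ∧ (∀ j, 𝒟'.toSpacetime.IsLateChart (B' j) O' τ₀' (ψ' j)) ∧ (∀ Rc : ℝ, ∃ τ₁ : ℝ, Pairwise (Function.onFun Disjoint fun i : Fin N' ↦ ψ' i.succ '' (B' i.succ).truncLateRegion τ₁ Rc)) ∧ (∀ i, Filter.Tendsto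 (fun t ↦ ϱ' i t / t) Filter.atTop (nhds 0)) ∧ {x | τ₀' < x 0 ∧ ∀ i, ϱ' i (x 0) < Kerr.radius (M' i * â' i) (poincareInv (mo' i).1 (mo' i).2 x)} ⊆ (U' : Set E4) ∧ (∀ τ, 0 ≤ R' 0 τ) ∧ (∃ τ₁ : ℝ, ∀ τ ≥ τ₁, ∀ j, 𝒟'.toSpacetime.truncDeviationCk (B' j) (ψ' j) 2 (R' j τ) τ ≤ ENNReal.ofReal (w' j * ε)) ∧ (∀ τ₁ > τ₀', O' \ ⋃ j, ψ' j '' {y | τ₁ < (B' j).time y.1 ∧ (B' j).radius y.1 ≤ R' j ((B' j).time y.1)} ⊆ 𝒟'.metric.causalPast 𝒟'.timeOrientation (⋃ j, ψ' j '' (B' j).truncTimeSlab (R' j τ₁) τ₁)) ∧ O' = Summit.FinalStateConjecture.exteriorOf 𝒟'.toCauchyDevelopment (⋃ j, ψ' j '' (B' j).lateRegion τ₀')) → (∃ (O'' : Set 𝒟'.carrier) (d' : FinalStateDecomposition 𝒟'.toSpacetime O'' 2), (∀ i, Kerr.IsSubextremal (d'.mass i) (d'.spin i)) ∧ O'' =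 Summit.FinalStateConjecture.exteriorOf 𝒟'.toCauchyDevelopment d'.charted ∧ Summit.FinalStateConjecture.HasExhaustiveCharts d'))

/-- item stmt-FinalStateConjecture-10120 · crux · rank 4 · open · by planner
why it might fail: Contains WCC, N<∞ and large-data ringdown at once; dies if an OPEN set of data keeps C²-hard debris forever (stably-trapped turbulence, arXiv:2411.17445) or spins up to extremality generically; and if no tube is breather-free, ε⋆=sSup ∅/2=0 demands eventually EXACT Kerr charts — false.
sources: arXiv:1710.01722, arXiv:0805.3880, arXiv:2104.08222, arXiv:2205.14808, arXiv:1610.08908, arXiv:2411.17445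
[crux] (the complement; card (ii) 'born not made' in coarse form) for every 3-manifold X,
Christodoulou-generically in admissibleVacuumData X: every MGHD 𝒟 has complete 𝓘⁺ AND there are a
margin δ > 0 and O ⊆ 𝒟 such that O is (δ, ε⋆)-quasi-settled exactly as in NoSoftBreather's
hypothesis, with ε⋆ := sSup{ε : 0 < ε ≤ 1 ∧ every (δ, ε')-tube with ε' ≤ ε is breather-free}/2 —
generic developments end up exhaustively charted within HALF THE BREATHER-FREE RADIUS of finitely
many receding (1−δ)-sub-extremal Kerrs plus radiation (contains weak cosmic censorship, N < ∞ and
coarse large-data ringdown; pre-formed hard shells, extremal and naked knives are its exceptional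
set). [deps: NoSoftBreather] [difficulty: open-problem] -/
@[route_item "route-FinalStateConjecture-PhotonSphereCapacity", crux]
def SubcriticalFinalState : Prop :=
  open Literature.Geometry.Lorentzian in ∀ (X : Type) [TopologicalSpace X] [ChartedSpace E3 X] [IsManifold (𝓡 3) ((⊤ : ℕ∞) : WithTop ℕ∞) X] [T2Space X] [SecondCountableTopology X] [ConnectedSpace X], InitialDataSet.IsChristodoulouGeneric (admissibleVacuumData X) (fun D ↦ ∀ 𝒟 : VacuumCauchyDevelopment D, 𝒟.IsMaximal → Summit.FinalStateConjecture.HasCompleteNullInfinity 𝒟.toCauchyDevelopment ∧ ∃ δ : ℝ, 0 < δ ∧ ∃ O : Set 𝒟.carrier, (∃ (N : ℕ) (M â : Fin N → ℝ) (mo : Fin N → lorentzGroup × E4) (τ₀ : ℝ) (U : TopologicalSpace.Opens E4) (ϱ : Fin N → ℝ → ℝ) (R : Fin (N + 1) → ℝ → ℝ), let B : Fin (N + 1) → ModelBackground := Fin.cases (motive := fun _ ↦ ModelBackground) ⟨U, fun _ ↦ Minkowski.bilin, fun x ↦ x 0, fun _ ↦ 0⟩ (fun i ↦ ⟨Kerr.exterior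 1 (â i), fun y ↦ (M i ^ 2) • Kerr.bilin 1 (â i) y, fun y ↦ M i * y 0, fun y ↦ M i * Kerr.radius (â i) y⟩); let w : Fin (N + 1) → ℝ := Fin.cases (motive := fun _ ↦ ℝ) 1 (fun i ↦ M i ^ 2); ∃ ψ : ∀ j, (B j).domain → 𝒟.carrier, (∀ i, 0 < M i ∧ |â i| ≤ 1 - δ) ∧ (∀ j, 𝒟.toSpacetime.IsLateChart (B j) O τ₀ (ψ j)) ∧ (∀ Rc : ℝ, ∃ τ₁ : ℝ, Pairwise (Function.onFun Disjoint fun i : Fin N ↦ ψ i.succ '' (B i.succ).truncLateRegion τ₁ Rc)) ∧ (∀ i, Filter.Tendsto (fun t ↦ ϱ i t / t) Filter.atTop (nhds 0)) ∧ {x | τ₀ < x 0 ∧ ∀ i, ϱ i (x 0) < Kerr.radius (M i * â i) (poincareInv (mo i).1 (mo i).2 x)} ⊆ (U : Set E4) ∧ (∀ τ, 0 ≤ R 0 τ) ∧ (∃ τ₁ : ℝ, ∀ τ ≥ τ₁, ∀ j, 𝒟.toSpacetime.truncDeviationCk (B j) (ψ j) 2 (R j τ) τ ≤ ENNReal.ofReal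 (w j * (sSup {ε : ℝ | 0 < ε ∧ ε ≤ 1 ∧ ∀ ε' : ℝ, 0 < ε' → ε' ≤ ε → (∀ (X' : Type) [TopologicalSpace X'] [ChartedSpace E3 X'] [IsManifold (𝓡 3) ((⊤ : ℕ∞) : WithTop ℕ∞) X'] [T2Space X'] [SecondCountableTopology X'] [ConnectedSpace X'], ∀ D' ∈ admissibleVacuumData X', ∀ 𝒟' : VacuumCauchyDevelopment D', 𝒟'.IsMaximal → Summit.FinalStateConjecture.HasCompleteNullInfinity 𝒟'.toCauchyDevelopment → ∀ O' : Set 𝒟'.carrier, (∃ (N' : ℕ) (M' â' : Fin N' → ℝ) (mo' : Fin N' → lorentzGroup × E4) (τ₀' : ℝ) (U' : TopologicalSpace.Opens E4) (ϱ' : Fin N' → ℝ → ℝ) (R' : Fin (N' + 1) → ℝ → ℝ), let B' : Fin (N' + 1) → ModelBackground := Fin.cases (motive := fun _ ↦ ModelBackground) ⟨U', fun _ ↦ Minkowski.bilin, fun x ↦ x 0, fun _ ↦ 0⟩ (fun i ↦ ⟨Kerr.exterior 1 (â' i), fun y ↦ (M' i ^ 2) • Kerr.bilin 1 (â' i) y,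 fun y ↦ M' i * y 0, fun y ↦ M' i * Kerr.radius (â' i) y⟩); let w' : Fin (N' + 1) → ℝ := Fin.cases (motive := fun _ ↦ ℝ) 1 (fun i ↦ M' i ^ 2); ∃ ψ' : ∀ j, (B' j).domain → 𝒟'.carrier, (∀ i, 0 < M' i ∧ |â' i| ≤ 1 - δ) ∧ (∀ j, 𝒟'.toSpacetime.IsLateChart (B' j) O' τ₀' (ψ' j)) ∧ (∀ Rc : ℝ, ∃ τ₁ : ℝ, Pairwise (Function.onFun Disjoint fun i : Fin N' ↦ ψ' i.succ '' (B' i.succ).truncLateRegion τ₁ Rc)) ∧ (∀ i, Filter.Tendsto (fun t ↦ ϱ' i t / t) Filter.atTop (nhds 0)) ∧ {x | τ₀' < x 0 ∧ ∀ i, ϱ' i (x 0) < Kerr.radius (M' i * â' i) (poincareInv (mo' i).1 (mo' i).2 x)} ⊆ (U' : Set E4) ∧ (∀ τ, 0 ≤ R' 0 τ) ∧ (∃ τ₁ : ℝ, ∀ τ ≥ τ₁, ∀ j, 𝒟'.toSpacetime.truncDeviationCk (B' j) (ψ' j) 2 (R' j τ) τ ≤ ENNReal.ofReal (w' j * ε'))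 ∧ (∀ τ₁ > τ₀', O' \ ⋃ j, ψ' j '' {y | τ₁ < (B' j).time y.1 ∧ (B' j).radius y.1 ≤ R' j ((B' j).time y.1)} ⊆ 𝒟'.metric.causalPast 𝒟'.timeOrientation (⋃ j, ψ' j '' (B' j).truncTimeSlab (R' j τ₁) τ₁)) ∧ O' = Summit.FinalStateConjecture.exteriorOf 𝒟'.toCauchyDevelopment (⋃ j, ψ' j '' (B' j).lateRegion τ₀')) → (∃ (O'' : Set 𝒟'.carrier) (d' : FinalStateDecomposition 𝒟'.toSpacetime O'' 2), (∀ i, Kerr.IsSubextremal (d'.mass i) (d'.spin i)) ∧ O'' = Summit.FinalStateConjecture.exteriorOf 𝒟'.toCauchyDevelopment d'.charted ∧ Summit.FinalStateConjecture.HasExhaustiveCharts d'))} / 2))) ∧ (∀ τ₁ > τ₀, O \ ⋃ j, ψ j '' {y | τ₁ < (B j).time y.1 ∧ (B j).radius y.1 ≤ R j ((B j).time y.1)} ⊆ 𝒟.metric.causalPast 𝒟.timeOrientation (⋃ j, ψ j '' (B j).truncTimeSlab (R j τ₁) τ₁)) ∧ O = Summit.FinalStateConjecture.exteriorOf 𝒟.toCauchyDevelopment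 (⋃ j, ψ j '' (B j).lateRegion τ₀))) 1

/-- item stmt-FinalStateConjecture-10119 · support · rank 3 · open · by planner
why it might fail: Radial pressure between the bottom and the outer top adds FIRST-order redshift 2∫4πr²p/(r−2m)dr; only the TOV balance caps p at O(ηρ·width/M) — a thick equilibrium shell with p/ρ = O(1) over width O(M_BH) gives depth O(η); κ may blow up for nested shells.
sources: doi:10.1016/j.jde.2008.05.010, arXiv:2102.08170, arXiv:1610.08908, Mathlib:antitoneOn_of_deriv_nonpos
[crux] (card K1, spherical form) there are κ, η₀ > 0 such that for every static spherically
symmetric configuration outside a Schwarzschild interior of mass M_BH — mass function m, potential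
ν, density ρ, radial/tangential pressures p, q ≥ 0 on r > 2M_BH with m' = 4πr²ρ, ν' = (m +
4πr³p)/(r(r − 2m)), anisotropic TOV p' = −(ρ + p)ν' + 2(q − p)/r, massless matter ρ = p + 2q, no
horizon 2m < r, total mass m ≤ (1 + η)M_BH with 0 < η ≤ η₀, and a vacuum gap above the horizon (m =
M_BH, ρ = p = 0 on (2M_BH, R₁]) — every well of the null potential V = e^{2ν}/r² has relative depth
≤ κη²: min(V r₁, V r₂) ≤ (1 + κη²)·V r_b whenever 2M_BH < r₁ < r_b < r₂. [difficulty: M] -/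
@[route_item "route-FinalStateConjecture-PhotonSphereCapacity"]
def CapacityLaw : Prop :=
  ∃ κ η₀ : ℝ, 0 < κ ∧ 0 < η₀ ∧ ∀ (Mbh η : ℝ) (m ν ρ p q : ℝ → ℝ), 0 < Mbh → 0 < η → η ≤ η₀ → (∀ r, 2 * Mbh < r → HasDerivAt m (4 * Real.pi * r ^ 2 * ρ r) r) → (∀ r, 2 * Mbh < r → HasDerivAt ν ((m r + 4 * Real.pi * r ^ 3 * p r) / (r * (r - 2 * m r))) r) → (∀ r, 2 * Mbh < r → HasDerivAt p (-(ρ r + p r) * ((m r + 4 * Real.pi * r ^ 3 * p r) / (r * (r - 2 * m r))) + 2 * (q r - p r) / r) r) → (∀ r, 2 * Mbh < r → 0 ≤ ρ r ∧ 0 ≤ p r ∧ 0 ≤ q r ∧ ρ r = p r + 2 * q r ∧ 2 * m r < r ∧ m r ≤ (1 + η) * Mbh) → (∃ R₁, 2 * Mbh < R₁ ∧ ∀ r, 2 * Mbh < r → r ≤ R₁ → m r = Mbh ∧ ρ r = 0 ∧ p r = 0) → ∀ r₁ rb r₂ : ℝ, 2 * Mbh < r₁ → r₁ < rb → rb < r₂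 → min (Real.exp (2 * ν r₁) / r₁ ^ 2) (Real.exp (2 * ν r₂) / r₂ ^ 2) ≤ (1 + κ * η ^ 2) * (Real.exp (2 * ν rb) / rb ^ 2)

/-- item stmt-FinalStateConjecture-10121 · support · rank 9 · open · by planner
sources: ChoquetBruhatGeroch1969CMP, arXiv:1309.7591, Ringstrom2009
[support] every admissible vacuum datum on a connected Hausdorff second-countable 3-manifold has a
maximal vacuum Cauchy development (Choquet-Bruhat–Geroch 1969 over the repaired structure
VacuumCauchyDevelopment of the prelude; Sbierski's dezornification); the anti-vacuity conjunct of
the Statement. [difficulty: XL] -/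
@[route_item "route-FinalStateConjecture-PhotonSphereCapacity", crux]
def MGHDExistence : Prop :=
  open Literature.Geometry.Lorentzian in ∀ (X : Type) [TopologicalSpace X] [ChartedSpace E3 X] [IsManifold (𝓡 3) ((⊤ : ℕ∞) : WithTop ℕ∞) X] [T2Space X] [SecondCountableTopology X] [ConnectedSpace X], ∀ D ∈ admissibleVacuumData X, ∃ 𝒟 : VacuumCauchyDevelopment D, 𝒟.IsMaximal

/-- item stmt-FinalStateConjecture-10122 · support · rank 9 · open · by planner
sources: arXiv:0811.0354, doi:10.1007/978-3-030-46622-0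
[support] (card P1(a), the signature identity of the mechanism) the Schwarzschild null potential
V_M(r) = (1 − 2M/r)/r² is second-order flat at the photon sphere: 1/(27M²) − V_M(3M(1 + x)) = x²(3 +
x)/(27M²(1 + x)³) for M > 0, x > −1 (proved in the planner's Sketch.lean by field_simp; ring).
[difficulty: provable-now] -/
@[route_item "route-FinalStateConjecture-PhotonSphereCapacity"]
def PhotonSphereFlatness : Prop :=
  ∀ M x : ℝ, 0 < M → -1 < x → 1 / (27 * M ^ 2) - (1 - 2 * M / (3 * M * (1 + x))) / (3 * M * (1 + x)) ^ 2 = x ^ 2 * (3 + x) / (27 * M ^ 2 * (1 + x) ^ 3)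

/-- item stmt-FinalStateConjecture-10123 · support · rank 9 · open · by planner
sources: doi:10.1088/0264-9381/7/4/011, doi:10.1103/physrevd.44.1891, arXiv:2102.08170
[support] (card P1(c), the law is attained) there are C, η₀ > 0 such that for 0 < η ≤ η₀ and M_BH >
0 the traceless Israel junction condition M/√f_M(R) − M_BH/√f_{M_BH}(R) = 2R(√f_{M_BH}(R) − √f_M(R))
(f_m(R) = 1 − 2m/R, M = (1 + η)M_BH) has a root R with 3M_BH < R < 3M, |R − 3M_BH(1 + η/2)| ≤
Cη²M_BH, and the glued potential (C_in(1 − 2M_BH/r)/r² inside, (1 − 2M/r)/r² outside, C_in =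
f_M(R)/f_{M_BH}(R)) has well depth min(tops) − V(R) = η²/(36M_BH²) + O(η³) (numerically checked in
this unit: depth/(η²/36) = 0.996, 0.964, 0.70 at η = 10⁻³, 10⁻², 10⁻¹; root error O(η⁴)).
[difficulty: M] -/
@[route_item "route-FinalStateConjecture-PhotonSphereCapacity"]
def ThinShellWell : Prop :=
  ∃ C η₀ : ℝ, 0 < C ∧ 0 < η₀ ∧ ∀ Mbh η : ℝ, 0 < Mbh → 0 < η → η ≤ η₀ → ∃ R : ℝ, 3 * Mbh < R ∧ R < 3 * (1 + η) * Mbh ∧ (1 + η) * Mbh / Real.sqrt (1 - 2 * (1 + η) * Mbh / R) - Mbh / Real.sqrt (1 - 2 * Mbh / R) = 2 * R * (Real.sqrt (1 - 2 * Mbh / R) - Real.sqrt (1 - 2 * (1 + η) * Mbh / R)) ∧ |R - 3 * Mbh * (1 + η / 2)| ≤ C * η ^ 2 * Mbh ∧ |(min ((1 - 2 * (1 + η) * Mbh / R) / (1 - 2 * Mbh / R) / (27 * Mbh ^ 2)) (1 / (27 * ((1 + η) * Mbh) ^ 2)) - (1 - 2 * (1 + η) * Mbh / R) / R ^ 2)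 - η ^ 2 / (36 * Mbh ^ 2)| ≤ C * η ^ 3 / Mbh ^ 2

/-- item stmt-FinalStateConjecture-10124 · assembly · rank 1 · open · by planner
sources: arXiv:1710.01722, Christodoulou1999
[assembly] NoSoftBreather → SubcriticalFinalState → MGHDExistence → FinalStateConjecture (the
root-level Statement decl). -/
@[route_item "route-FinalStateConjecture-PhotonSphereCapacity"]
def Assembly : Prop :=
  NoSoftBreather → SubcriticalFinalState → MGHDExistence → FinalStateConjecture

/-! D-0027 §2.1 — DECIDING THEOREM (planner-authored via `route open/edit --closes-file`; by planner-plancard-FinalStateConjecture-FinalSt-af71568c-0 2026-08-15T15:12:33Z):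
its hypotheses are this route's items and its conclusion the sub-problem Statement (glue_lint), and it elaborates with this file. -/

@[closes "route-FinalStateConjecture-PhotonSphereCapacity"] theorem closes (hB : NoSoftBreather) (hA : SubcriticalFinalState) (hE : MGHDExistence) :
    FinalStateConjecture := by
  intro X _ _ _ _ _ _
  -- (1) the breather-free radius is positive and half of it is breather-free (abstract in the tube predicate T)
  have half : ∀ (T : ℝ → Prop) (ε₀ : ℝ), 0 < ε₀ → (∀ ε : ℝ, 0 < ε → ε ≤ ε₀ → T ε) →
      T (sSup {ε : ℝ | 0 < ε ∧ ε ≤ 1 ∧ ∀ ε' : ℝ, 0 < ε' → ε' ≤ ε → T ε'} / 2) := by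
    intro T ε₀ hε₀ hT
    set S : Set ℝ := {ε : ℝ | 0 < ε ∧ ε ≤ 1 ∧ ∀ ε' : ℝ, 0 < ε' → ε' ≤ ε → T ε'} with hS
    have hmem : min ε₀ 1 ∈ S :=
      ⟨lt_min hε₀ one_pos, min_le_right _ _, fun ε' h1 h2 ↦ hT ε' h1 (h2.trans (min_le_left _ _))⟩
    have hbdd : BddAbove S := ⟨1, fun ε hε ↦ hε.2.1⟩
    have hpos : 0 < sSup S := lt_of_lt_of_le (lt_min hε₀ one_pos) (le_csSup hbdd hmem)
    obtain ⟨ε', hε'S, hlt'⟩ := exists_lt_of_lt_csSup ⟨_, hmem⟩ (show sSup S / 2 < sSup S by linarith)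
    exact hε'S.2.2 _ (by linarith) hlt'.le
  -- (2) Christodoulou codimension is monotone under shrinking the exceptional set
  have mono : ∀ (P Q : Literature.Geometry.Lorentzian.InitialDataSet (𝓡 3) X → Prop),
      (∀ d ∈ Literature.Geometry.Lorentzian.admissibleVacuumData X, Q d → P d) →
      Literature.Geometry.Lorentzian.InitialDataSet.HasCodimAtLeastIn (Literature.Geometry.Lorentzian.admissibleVacuumData X)
        {d ∈ Literature.Geometry.Lorentzian.admissibleVacuumData X | ¬ Q d} 1 →
      Literature.Geometry.Lorentzian.InitialDataSet.HasCodimAtLeastIn (Literature.Geometry.Lorentzian.admissibleVacuumData X)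
        {d ∈ Literature.Geometry.Lorentzian.admissibleVacuumData X | ¬ P d} 1 := by
    intro P Q hPQ hQ d hd
    obtain ⟨F, hF, h0, hinj, hD, hE'⟩ := hQ d ⟨hd.1, fun h ↦ hd.2 (hPQ d hd.1 h)⟩
    exact ⟨F, hF, h0, hinj, hD, fun c hc hc' ↦ hE' c hc ⟨hc'.1, fun h ↦ hc'.2 (hPQ _ hc'.1 h)⟩⟩
  -- (3) pointwise: subcritical + breather-free tube ⇒ settles; MGHD existence for the first conjunct
  refine mono _ _ ?_ (hA X)
  intro d hd hP
  refine ⟨hE X d hd, fun 𝒟 h𝒟 ↦ ?_⟩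
  obtain ⟨hscri, δ, hδ, O, hQS⟩ := hP 𝒟 h𝒟
  obtain ⟨ε₀, hε₀, hT⟩ := hB δ hδ
  exact ⟨hscri, half _ ε₀ hε₀ hT X d hd 𝒟 h𝒟 hscri O hQS⟩

end Summit.FinalStateConjecture.FinalStateConjecture.Theses.PhotonSphereCapacity
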